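import Literature.Barriers.AtomisticToContinuum.OneDimensionalHardCoreProofs
import HarnessLib

/-!
# Hard rods, Part C′: Lenard's cofactor formula with a one-body weight and a shift

`Literature/Barriers/AtomisticToContinuum/` (D-0021 barrier catalogue), sub-problem
`BoseEinsteinCondensation`; part of the typed proof of the rod barrier `OneDimensionalHardRods`
(`OneDimensionalHardCoreRods.lean`, eighth audit of `OneDimensionalHardCore`, 2026-08-16).

Part C of `OneDimensionalHardCoreProofs.lean` (`integral_sgn_det_det`) integrates the
sign-twisted product of two Vandermonde (free-fermion Slater) determinants with ONE inserted point
each, `∏_j s(X_j) · det V(e(a), e(X)) · conj det V(e(b), e(X))`, by Laplace expansion along the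
inserted row and Andréief's identity, obtaining `n! ⟨u(b), adj(G) u(a)⟩` with the one-body Gram
matrix `G_{kl} = ∫ s e^k conj(e)^l`. For hard rods (step (3) of the paper proof in the docstring of
`OneDimensionalHardRods`) two generalisations are needed and are supplied here verbatim along the
same proof: an arbitrary bounded measurable complex ONE-BODY WEIGHT `σ` in place of the sign `s`
(it absorbs Girardeau's sign count `(−1)^m` and the spectator Vandermonde phases), and a measurable
SHIFT `T` of the variables of the conjugated determinant (the crossed fermions are translated by the
rod length): `integral_weight_det_det_shift`,
`∫ ∏_j σ(X_j) det V(e(a), e(X)) conj det V(e(b), e(T X)) dμ^{⊗n} = n! ⟨u(b), adj(G_{σ,T}) u(a)⟩`,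
`(G_{σ,T})_{kl} = ∫ σ(x) e(x)^k conj(e(Tx))^l dμ` (`gramShift`). With `σ = s`, `T = id` this is
Part C again (`gramShift_sgnFun_id`).

## References

* [ForresterEtAl2003] P. J. Forrester et al., Phys. Rev. A 67 (2003) 043607: §2.1.2 (Heine /
  Andréief identity and Lenard's Toeplitz determinant).
* [MazzantiEtAl2008] F. Mazzanti et al., Phys. Rev. Lett. 100 (2008) 020401: Eqs. (2)–(3) and (7)
  (rod coordinates; the shift by `ja` of crossed rods in exact expectation formulas).
-/

noncomputable section

open MeasureTheory Finset Complex Matrix Equiv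
open scoped BigOperators Real ComplexConjugate

namespace Literature.Barriers.AtomisticToContinuum.BoseGas

section WeightedLenard

variable {n : ℕ}

/-- The **weighted, shifted one-body Gram matrix**
`G_{kl} = ∫ σ(x) e(x)^k conj(e(T x))^l dμ` (for rods: `σ` the unimodular crossing weight, `T` the
translation of crossed coordinates by the rod length). [cite: MazzantiEtAl2008, Eq. (7)] -/
def gramShift (n : ℕ) (μ : Measure ℝ) (L : ℝ) (σ : ℝ → ℂ) (T : ℝ → ℝ) :
    Matrix (Fin (n + 1)) (Fin (n + 1)) ℂ :=
  of fun k l => ∫ x, σ x * eL L x ^ (k : ℕ) * conj (eL L (T x)) ^ (l : ℕ) ∂μ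

/-- The weighted, shifted Gram integrands are bounded by `1`, hence integrable on a finite
measure. [folklore] -/
theorem integrable_weight_pow_pow (μ : Measure ℝ) [IsFiniteMeasure μ] (L : ℝ) {σ : ℝ → ℂ}
    {T : ℝ → ℝ} (hσ : Measurable σ) (hσ1 : ∀ x, ‖σ x‖ ≤ 1) (hT : Measurable T) (k l : ℕ) :
    Integrable (fun x => σ x * eL L x ^ k * conj (eL L (T x)) ^ l) μ := by
  refine Integrable.mono' (integrable_const (1 : ℝ)) ?_ (Filter.Eventually.of_forall fun x => ?_)
  · refine Measurable.aestronglyMeasurable ?_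
    refine (hσ.mul ((continuous_eL L).measurable.pow_const k)).mul ?_
    exact (Complex.continuous_conj.measurable.comp
      ((continuous_eL L).measurable.comp hT)).pow_const l
  · rw [norm_mul, norm_mul, norm_pow, norm_pow, Complex.norm_conj, norm_eL, norm_eL, one_pow,
      one_pow, mul_one, mul_one]
    exact hσ1 x

/-- **Lenard's formula with a one-body weight and a shift (integrated form).** For a bounded
measurable complex weight `σ` and a measurable map `T`,
`∫ ∏_j σ(X_j) · det V(e(a), e(X)) · conj det V(e(b), e(T X)) dμ^{⊗n} = n! ⟨u(b), adj(G_{σ,T}) u(a)⟩`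
— Laplace expansion along the inserted points and Andréief's identity, exactly as Part C of the
Proofs file. [cite: ForresterEtAl2003, §2.1.2] -/
theorem integral_weight_det_det_shift (μ : Measure ℝ) [IsFiniteMeasure μ] (L a b : ℝ)
    {σ : ℝ → ℂ} {T : ℝ → ℝ} (hσ : Measurable σ) (hσ1 : ∀ x, ‖σ x‖ ≤ 1) (hT : Measurable T) :
    ∫ X : Fin n → ℝ, (∏ j, σ (X j)) *
        (det (vandermonde fun j => eL L ((Fin.cons a X : Fin (n + 1) → ℝ) j)) *
          conj (det (vandermonde fun j =>
            eL L ((Fin.cons b (fun i => T (X i)) : Fin (n + 1) → ℝ) j))))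
        ∂(Measure.pi fun _ => μ) =
      (n.factorial : ℂ) *
        (star (uVec n L b) ⬝ᵥ ((gramShift n μ L σ T).adjugate *ᵥ uVec n L a)) := by
  -- Step 1: pointwise expansion of the integrand as a double sum over (p, q).
  set F : Fin (n + 1) → Fin n → ℝ → ℂ :=
    fun p t x => σ x * eL L x ^ ((p.succAbove t : Fin (n + 1)) : ℕ) with hF
  set G : Fin (n + 1) → Fin n → ℝ → ℂ :=
    fun q t x => conj (eL L (T x)) ^ ((q.succAbove t : Fin (n + 1)) : ℕ) with hG
  have hexp : ∀ X : Fin n → ℝ,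
      (∏ j, σ (X j)) *
        (det (vandermonde fun j => eL L ((Fin.cons a X : Fin (n + 1) → ℝ) j)) *
          conj (det (vandermonde fun j =>
            eL L ((Fin.cons b (fun i => T (X i)) : Fin (n + 1) → ℝ) j)))) =
      ∑ p : Fin (n + 1), ∑ q : Fin (n + 1),
        (((-1) ^ (p : ℕ) * eL L a ^ (p : ℕ)) * ((-1) ^ (q : ℕ) * conj (eL L b) ^ (q : ℕ))) *
          (det (of fun r t => F p t (X r)) * det (of fun r t => G q t (X r))) := by
    intro X
    rw [det_vandermonde_cons_eq_sum, det_vandermonde_cons_eq_sum, map_sum, Finset.sum_mul_sum,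
      Finset.mul_sum]
    refine Finset.sum_congr rfl fun p _ => ?_
    rw [Finset.mul_sum]
    refine Finset.sum_congr rfl fun q _ => ?_
    have hFdet : (∏ j, σ (X j)) *
        det (of fun r t => eL L (X r) ^ ((p.succAbove t : Fin (n + 1)) : ℕ)) =
        det (of fun r t => F p t (X r)) := by
      rw [hF, ← det_mul_column]
      rfl
    have hGdet : conj (det (of fun r t => eL L (T (X r)) ^ ((q.succAbove t : Fin (n + 1)) : ℕ))) =
        det (of fun r t => G q t (X r)) := by
      rw [hG, RingHom.map_det]
      congr 1
      ext r t
      simp [map_pow]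
    rw [map_mul, map_mul, map_pow, map_pow, map_neg, map_one, hGdet, ← hFdet]
    ring
  simp_rw [hexp]
  -- Step 2: integrate term by term using Andréief.
  have hFG : ∀ p q : Fin (n + 1), ∀ t t' : Fin n,
      Integrable (fun x => F p t x * G q t' x) μ := by
    intro p q t t'
    simpa [hF, hG, mul_assoc] using integrable_weight_pow_pow μ L hσ hσ1 hT _ _
  have hint : ∀ p q : Fin (n + 1), Integrable (fun X : Fin n → ℝ =>
      (((-1) ^ (p : ℕ) * eL L a ^ (p : ℕ)) * ((-1) ^ (q : ℕ) * conj (eL L b) ^ (q : ℕ))) *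
        (det (of fun r t => F p t (X r)) * det (of fun r t => G q t (X r))))
      (Measure.pi fun _ => μ) := fun p q =>
    (integrable_det_mul_det μ (F p) (G q) (hFG p q)).const_mul _
  rw [integral_finsetSum _ fun p _ => integrable_finsetSum _ fun q _ => hint p q]
  simp_rw [integral_finsetSum _ fun q _ => hint _ q, integral_const_mul,
    integral_det_mul_det μ (F _) (G _) (hFG _ _)]
  -- Step 3: identify the cofactors.
  have hsub : ∀ p q : Fin (n + 1),
      (of fun t t' => ∫ x, F p t x * G q t' x ∂μ) =
        (gramShift n μ L σ T).submatrix p.succAbove q.succAbove := by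
    intro p q
    ext t t'
    simp only [gramShift, of_apply, submatrix_apply, hF, hG, mul_assoc]
  simp_rw [hsub]
  have hadj : ∀ p q : Fin (n + 1),
      (gramShift n μ L σ T).adjugate q p =
        (-1) ^ ((p : ℕ) + (q : ℕ)) *
          det ((gramShift n μ L σ T).submatrix p.succAbove q.succAbove) :=
    fun p q => adjugate_fin_succ_eq_det_submatrix _ _ _
  -- Step 4: rewrite the bilinear form.
  simp only [dotProduct, mulVec, uVec, Pi.star_apply, star_pow, Complex.star_def, hadj,
    Finset.mul_sum]
  rw [Finset.sum_comm]
  refine Finset.sum_congr rfl fun q _ => Finset.sum_congr rfl fun p _ => ?_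
  rw [pow_add]
  ring

/-- Consistency with Part C: for the sign weight and no shift, the weighted Gram matrix is the
sign-twisted one (`gramS`). [folklore] -/
theorem gramShift_sgnFun_id (μ : Measure ℝ) (L a b : ℝ) :
    gramShift n μ L (fun x => (sgnFun a b x : ℂ)) id = gramS n μ L a b := by
  ext k l
  simp [gramShift, gramS]

end WeightedLenard


/-! ### Part E′: the rod weight, shift and one-body matrix in closed form -/

section RodGram

variable {n : ℕ} {Lp a t : ℝ}

/-- The **rod crossing weight** on the compressed ring `[0, L']`: `σ = −e^{iπna/L'}` on the crossed
coordinates `x ≤ t − a`, `σ = 1` otherwise (it absorbs Girardeau's sign `(−1)^m` and the spectator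
Vandermonde phases; step (2) of the paper proof). [cite: MazzantiEtAl2008, Eq. (7)] -/
def rodWeight (n : ℕ) (Lp a t : ℝ) (x : ℝ) : ℂ :=
  if x ≤ t - a then -cexp (↑(π * n * a / Lp) * I) else 1

/-- The **rod shift**: crossed compressed coordinates `x ≤ t − a` are translated by the rod length.
[cite: MazzantiEtAl2008, text after Eq. (3)] -/
def rodShift (a t : ℝ) (x : ℝ) : ℝ := if x ≤ t - a then x + a else x

/-- The spectators' compressed domain at tagged displacement `t`: `[0, t − a] ∪ (t, L']` (no
coordinate in the window `(t − a, t]`). [cite: MazzantiEtAl2008, text after Eq. (3)] -/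
def rodDomain (Lp a t : ℝ) : Set ℝ := Set.Icc 0 (t - a) ∪ Set.Ioc t Lp

/-- The **centred rod phases** `c_l = e^{iπna/L'} conj(e(a))^l = e^{−ik_l a}`,
`k_l = 2π(l − n/2)/L'`. [folklore] -/
def rodPhase (n : ℕ) (Lp a : ℝ) (l : ℕ) : ℂ :=
  cexp (↑(π * n * a / Lp) * I) * conj (eL Lp a) ^ l

/-- **Lenard's rod matrix** `A_{kl} = δ_{kl} − q_{(0,t)}(k−l) − c_l q_{(0,t−a)}(k−l)`
(`= 1 − 2Q`, `lenardMatrix`, at `a = 0`): the weighted, shifted Gram matrix of the rod problem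
divided by `L'` (`gramShift_rod_eq_smul`). [folklore] -/
def rodMatrix (n : ℕ) (Lp a t : ℝ) : Matrix (Fin (n + 1)) (Fin (n + 1)) ℂ :=
  of fun k l => (if k = l then (1 : ℂ) else 0) - qCoeff Lp 0 t ((k : ℤ) - (l : ℤ)) -
    rodPhase n Lp a l * qCoeff Lp 0 (t - a) ((k : ℤ) - (l : ℤ))

/-- The rod weight is measurable. [folklore] -/
theorem measurable_rodWeight (n : ℕ) (Lp a t : ℝ) : Measurable (rodWeight n Lp a t) := by
  unfold rodWeight
  exact Measurable.ite measurableSet_Iic measurable_const measurable_const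

/-- The rod weight is unimodular, in particular bounded by `1`. [folklore] -/
theorem norm_rodWeight_le (n : ℕ) (Lp a t x : ℝ) : ‖rodWeight n Lp a t x‖ ≤ 1 := by
  unfold rodWeight
  split_ifs
  · rw [norm_neg, norm_exp_ofReal_mul_I]
  · rw [norm_one]

/-- The rod shift is measurable. [folklore] -/
theorem measurable_rodShift (a t : ℝ) : Measurable (rodShift a t) := by
  unfold rodShift
  exact Measurable.ite measurableSet_Iic (measurable_id.add_const a) measurable_id

/-- `∫₀^τ e^{2πimx/L'} dx = L' q_{(0,τ)}(m)` for `τ ≥ 0`. [folklore] -/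
theorem intervalIntegral_ez_eq_qCoeff (hLp : 0 < Lp) {τ : ℝ} (hτ : 0 ≤ τ) (m : ℤ) :
    ∫ x in (0 : ℝ)..τ, ez Lp m x = (Lp : ℂ) * qCoeff Lp 0 τ m := by
  unfold qCoeff
  rw [min_eq_left hτ, max_eq_right hτ, ← mul_assoc, mul_inv_cancel₀ (by exact_mod_cast hLp.ne'),
    one_mul, intervalIntegral.integral_of_le hτ, integral_Ioc_eq_integral_Ioo]

/-- `e(x + a) = e(x) e(a)`. [folklore] -/
theorem eL_add (Lp x a : ℝ) : eL Lp (x + a) = eL Lp x * eL Lp a := by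
  unfold eL
  rw [← Complex.exp_add]
  congr 1
  push_cast
  ring

/-- The crossed block of the rod Gram matrix: on `[0, t − a]` the weight is the constant
`−e^{iπna/L'}` and the shift is `+a`, so the entry is `−c_l · L' q_{(0,t−a)}(k − l)`. [folklore] -/
theorem setIntegral_rod_crossed (hLp : 0 < Lp) (hat : a ≤ t) (k l : ℕ) :
    ∫ x in Set.Icc 0 (t - a), rodWeight n Lp a t x * eL Lp x ^ k *
        conj (eL Lp (rodShift a t x)) ^ l =
      -(rodPhase n Lp a l * ((Lp : ℂ) * qCoeff Lp 0 (t - a) ((k : ℤ) - (l : ℤ)))) := by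
  have hτ : 0 ≤ t - a := sub_nonneg.mpr hat
  have hpt : ∀ x ∈ Set.Icc 0 (t - a), rodWeight n Lp a t x * eL Lp x ^ k *
      conj (eL Lp (rodShift a t x)) ^ l =
      -rodPhase n Lp a l * ez Lp ((k : ℤ) - (l : ℤ)) x := by
    intro x hx
    have hle : x ≤ t - a := hx.2
    simp only [rodWeight, rodShift, if_pos hle, rodPhase]
    rw [eL_add, map_mul, mul_pow, ← eL_pow_mul_conj_pow]
    ring
  rw [setIntegral_congr_fun measurableSet_Icc hpt, integral_const_mul, integral_Icc_eq_integral_Ioc,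
    ← intervalIntegral.integral_of_le hτ, intervalIntegral_ez_eq_qCoeff hLp hτ]
  ring

/-- The uncrossed block: on `(t, L']` the weight is `1` and there is no shift, so the entry is
`L'δ_{kl} − L' q_{(0,t)}(k − l)`. [folklore] -/
theorem setIntegral_rod_uncrossed (hLp : 0 < Lp) (ha : 0 ≤ a) (ht0 : 0 ≤ t) (htL : t ≤ Lp)
    (k l : ℕ) :
    ∫ x in Set.Ioc t Lp, rodWeight n Lp a t x * eL Lp x ^ k * conj (eL Lp (rodShift a t x)) ^ l =
      (Lp : ℂ) * ((if (k : ℤ) = l then (1 : ℂ) else 0) - qCoeff Lp 0 t ((k : ℤ) - (l : ℤ))) := by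
  set m : ℤ := (k : ℤ) - (l : ℤ) with hm
  have hpt : ∀ x ∈ Set.Ioc t Lp, rodWeight n Lp a t x * eL Lp x ^ k *
      conj (eL Lp (rodShift a t x)) ^ l = ez Lp m x := by
    intro x hx
    have hgt : ¬ x ≤ t - a := not_le.mpr (by linarith [hx.1])
    simp only [rodWeight, rodShift, if_neg hgt, one_mul]
    rw [eL_pow_mul_conj_pow]
  rw [setIntegral_congr_fun measurableSet_Ioc hpt, ← intervalIntegral.integral_of_le htL]
  have hii : ∀ u v : ℝ, IntervalIntegrable (ez Lp m) volume u v := fun u v =>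
    (continuous_ez Lp m).intervalIntegrable u v
  rw [← intervalIntegral.integral_add_adjacent_intervals (hii t 0) (hii 0 Lp),
    intervalIntegral.integral_symm, intervalIntegral_ez_eq_qCoeff hLp ht0,
    intervalIntegral.integral_of_le hLp.le, ← integral_Icc_eq_integral_Ioc, integral_ez_Icc hLp]
  have hm0 : m = 0 ↔ (k : ℤ) = l := by rw [hm, sub_eq_zero]
  by_cases hkl : (k : ℤ) = l
  · rw [if_pos (hm0.mpr hkl), if_pos hkl]; ring
  · rw [if_neg (mt hm0.mp hkl), if_neg hkl]; ring

/-- The two pieces of the compressed domain are disjoint. [folklore] -/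
theorem disjoint_rodDomain (ha : 0 ≤ a) (t : ℝ) : Disjoint (Set.Icc 0 (t - a)) (Set.Ioc t Lp) := by
  rw [Set.disjoint_left]
  intro x hx hx'
  have h1 := hx.2
  have h2 := hx'.1
  linarith

/-- The compressed domain has finite Lebesgue measure. [folklore] -/
instance isFiniteMeasure_restrict_rodDomain (Lp a t : ℝ) :
    IsFiniteMeasure (volume.restrict (rodDomain Lp a t)) := by
  rw [isFiniteMeasure_restrict]
  unfold rodDomain
  exact (measure_union_lt_top (by rw [Real.volume_Icc]; exact ENNReal.ofReal_lt_top)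
    (by rw [Real.volume_Ioc]; exact ENNReal.ofReal_lt_top)).ne

/-- **The rod Gram matrix in closed form**: over the compressed domain, with the rod weight and
the rod shift, the weighted shifted Gram matrix is `L' ·` Lenard's rod matrix. [folklore] -/
theorem gramShift_rod_eq_smul (hLp : 0 < Lp) (ha : 0 ≤ a) (hat : a ≤ t) (htL : t ≤ Lp) :
    gramShift n (volume.restrict (rodDomain Lp a t)) Lp (rodWeight n Lp a t) (rodShift a t) =
      (Lp : ℂ) • rodMatrix n Lp a t := by
  have ht0 : 0 ≤ t := ha.trans hat
  ext k l
  simp only [gramShift, rodMatrix, of_apply, Matrix.smul_apply, smul_eq_mul]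
  unfold rodDomain
  have hint : ∀ s : Set ℝ, IsFiniteMeasure (volume.restrict s) →
      Integrable (fun x => rodWeight n Lp a t x * eL Lp x ^ (k : ℕ) *
        conj (eL Lp (rodShift a t x)) ^ (l : ℕ)) (volume.restrict s) := fun s hs =>
    integrable_weight_pow_pow (volume.restrict s) Lp (measurable_rodWeight n Lp a t)
      (norm_rodWeight_le n Lp a t) (measurable_rodShift a t) k l
  rw [Measure.restrict_union (disjoint_rodDomain ha t) measurableSet_Ioc,
    integral_add_measure (hint _ inferInstance) (hint _ inferInstance),
    setIntegral_rod_crossed hLp hat, setIntegral_rod_uncrossed hLp ha ht0 htL]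
  have hkl : ((k : ℤ) = l) ↔ k = l := by
    constructor
    · intro h; exact Fin.ext (by exact_mod_cast h)
    · intro h; rw [h]
  by_cases h : k = l
  · rw [if_pos h, if_pos (hkl.mpr h)]; ring
  · rw [if_neg h, if_neg (mt hkl.mp h)]; ring

/-- At zero diameter the rod phases are `1`. [folklore] -/
theorem rodPhase_zero (n : ℕ) (Lp : ℝ) (l : ℕ) : rodPhase n Lp 0 l = 1 := by
  simp [rodPhase, eL]

/-- **Consistency with Lenard's matrix**: at `a = 0` the rod matrix is `1 − 2Q`
(`lenardMatrix n L' 0 t`). [folklore] -/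
theorem rodMatrix_zero (n : ℕ) (Lp t : ℝ) : rodMatrix n Lp 0 t = lenardMatrix n Lp 0 t := by
  ext k l
  simp only [rodMatrix, lenardMatrix, of_apply, rodPhase_zero, one_mul, sub_zero]
  ring

end RodGram


end Literature.Barriers.AtomisticToContinuum.BoseGas

end
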